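import Summits.HodgeConjecture.HodgeConjecture.Theorems.F0P6bWDock
import Summits.HodgeConjecture.HodgeConjecture.Theorems.F0P6aDatumOfInputsDefs
import Literature.AlgebraicGeometry.AbelianSchemes.DockKernelReadingRank
import Literature.AlgebraicGeometry.AbelianSchemes.PolarisedIsogenyKernelShiftedIsotropic
import Literature.AlgebraicGeometry.GroupSchemes.TorsionLayerBlockIdempotents
import Literature.AlgebraicGeometry.AbelianSchemes.FrobeniusKernelLawBlockAssembly
import Summits.HodgeConjecture.HodgeConjecture.Theorems.F0P6bWeilShiftedIsotropy
import Literature.AlgebraicGeometry.AbelianSchemes.AbelianSchemeOverCommOfReduced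
import Literature.AlgebraicGeometry.AbelianSchemes.AbelianSchemeOverHomOfReduced
import Literature.NumberTheory.NumberFields.CMBlockIdempotentAtLevel
import Literature.NumberTheory.NumberFields.GaloisConjugatePrimeIdealArithmetic
import HarnessLib
import HarnessLib.Audit.LibrarySuggestionsDenyListCruxes

/-!
# `F0P6aRoofWInstantiationHead` — ★ RE-HOME of the crux workfile `Lines/F0_P6a_RoofWInstantiation.lean` (tree ED. 2 sha16 2afdc2492f43fe94, 458 l., 5 declaration commands, code-`sorry`-free), PART 1 of 2

This `Theorems/` module is the TREE BYTES of that workfile with the NAMESPACE KEPT, so every fully-qualified name is UNCHANGED; only this module docstring is re-headed,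
the `Lines` imports are switched to their ★ re-homed twins — `Lines.F0_P6b_WDock` → ★ `Theorems.F0P6bWDock`; `Lines.F0_P6a_DatumOfInputs` → ★ `Theorems.F0P6aDatumOfInputsDefs` — and the audit carrier `LibrarySuggestionsDenyListCruxes` is CARRIED on this root part (bare import, LEAD «M-142d» (1) rule «P-κ»; parts 2…n inherit it transitively)
Why a re-home: a `Theorems/` file cannot import a `Lines/` workfile (F0P6-ref1 o-6), and closing stmt-HodgeConjecture-24832 `--as proved --by <Theorems decl>` at rung 0 needs the
sorry-free `Lines` chain behind the gate (RE-HOME TABLE v1.7, LA7-plan (g7); PLAN «L3 cone RE-HOME» v1, LA3-plan (g5); LEAD F0P6-plan (g5) «M-140» (1)∕(4), 2026-09-02).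
SIZE LINT (`Theorems/` files with proofs ≤ 400 l.): the workfile is cut into 2 consecutive parts `F0P6aRoofWInstantiationHead` → `F0P6aRoofWInstantiation`; this is PART 1 (tree lines :1–:307); each later part imports the previous one and re-opens the scopes open at its cut with their `variable`∕`open`∕`set_option` lines replayed verbatim; the LAST part `F0P6aRoofWInstantiation` is the module the `Lines/` shim and consumers import.
After the chain is ★ the `Lines` workfile becomes a one-import SHIM of `F0P6aRoofWInstantiation` (a `Lines/` write, batched per cone on the LEAD՚s word), so no environment holds two copies (NO-CROSS-IMPORT).
It asserts nothing beyond what the workfile already proves.  HC_CM is proved only modulo the 7 printed citations (2 remaining: hLiu418 = stmt-HodgeConjecture-24832, h413 = stmt-HodgeConjecture-24833) until rung 0 closes; a re-home is count-neutral.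

## Original module docstring (verbatim)
# F0 · P6a — LEAFLET cand `Lines/F0_P6a_RoofWInstantiation.lean` ED. 2: THE `w`-BLOCK LAW AT `x̄` — the W-DOCK package INSTANTIATED at the special fibre and fed to
# ★ (rL-asm)'s `hlaw` binder at the index `v = w` (line L3 ROOF road, LA3-plan (g2) ruling 07:34:47Z (C) «GAP-2», A-p03 (g32) primary pen, F0P6b-plan (g5) consult)

`crux_decl: Summit.HodgeConjecture.HodgeConjecture.Theses.HCCMUnconditional.HLiu418`.  Cell `hodgecm-mathlib` (D-0151), «GO 500» half A line L3 (socket `stub_ROOF0` of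
`Lines/F0_P6a_StubFROB.lean`; W3 leaflet `Lines/F0_P6a_RoofFrobKernelLawAssembly.lean` binder `hlaw` at `v = w`).  HOME cand (A-p03 (g32)); Lines currency, nothing registered,
no socket statement touched; imports the SERVED W-DOCK ED. 4 + D-LINE ED. 2 + ★ files.  Namespace `Summit.HodgeConjecture.HodgeConjecture.Cruxes.HLiu418.F0P6aRoofWInstantiation`.
HC_CM is proved only modulo the 7 printed citations (2 remaining: hLiu418 = stmt-HodgeConjecture-24832, h413 = stmt-HodgeConjecture-24833) until rung 0 closes; count-neutral.

EDITION 2 (A-p03 (g33); K4-era, D-chain): ED. 1 f62ef70b483c5730 with its §1b «(I-iso) at `e₀`, all `T`» (the P6b pack pasted by copy, :104–:215) REPLACED by the import of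
its ★ re-home `Summits/HodgeConjecture/HodgeConjecture/Theorems/F0P6bWeilShiftedIsotropy.lean` (desk F0P6b-plan (g7) row; same two names `e₀_comp_cartierDualMap_eq_one_of_zsmul_comp_eq_one`,
`hiso_e₀`, now in namespace `…Cruxes.HLiu418.F0P6bWeilShiftedIsotropy`, brought into scope by one `open`); the three §1b-only imports dropped; §1, §2–§4 BYTE-IDENTICAL to ED. 1
(statements, docstrings, proofs, names) — every head (`hlaw_w_of_wDockPackage`, `hlaw_w_sch₀Of`, `hlaw_w_sch₀Of_of_twistNorm`) keeps its type token for token.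
EDITION 2 v2 (A-p03 (g34), 2026-09-02T12:20Z): + LA1-p01 (g4)'s RETIRE-MAP row for this leaflet — `import Literature.NumberTheory.NumberFields.GaloisConjugatePrimeIdealArithmetic` (★ ED. 2
p851411) and the ED. 1 §1 local copy of `sub_one_mem_pow_sup_span` (:91–:103) DROPPED in favour of `open Literature.NumberTheory.NumberFields (sub_one_mem_pow_sup_span)`; its one
call site (§2 `hlaw_w_of_wDockPackage`, the `hfix` bridge) is byte-identical; every head keeps its type token for token.

THE ROW.  At a special point `x̄` of the localised model, with `A_x̄ = sch₀Of 𝓜 w I.univ x̄` and the reduced leg `q̄ : A_x̄ → B̄` of the roof (LEGS), the (rL-asm) assembler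
(W3 `hL_sch₀Of`) asks at the index `v = w` for: «for every `n`, every `q`-torsion `T`-point `x` of `A_x̄` killed by `𝔭_wⁿ`: `x ≫ F_q = 1 ↔ ∀ a ∈ 𝔠, x ≫ ι(a) ≫ q̄ = 1`».
This file PAYS it from the W-DOCK: (1) the package `WDockPackage κ̄(w) p f A_x̄ …` is ONE `exact wDockPackage_of_baseChange₂ …` over the spine rows `I.rosati`, `I.polQuasiInv`
(P6b probe §C₂) at a `c•w`-block idempotent `εu` of level `q` (`εu² = εu + q·c`); (2) ★ W-DOCK §6.6 `WBlockLawED4b.law_w_of_points` at `𝒦 := Φ𝒢` (the Frobenius sublayer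
of the `c•w`-layer `𝒢l`; the (E) socket becomes `Iff.rfl` and its CONTENT the single inclusion «`Φ𝒢 ⊆ Ker q̄`», ★ `DockKernelReading.iff_of_dockClauses` over the dock
clauses `hdock`∕`hF` of the ROOF road), with `hqβ := hqβ_of_roof4 ∘ (r4₀-q)`, (KW) `:= WBlockLawED4c.hKW_of_isotropy_of_finrank'` over (I-iso) ★ p849807 (all `T`, at the W-line's
`e₀`) and (I-rk) `WBlockLawLA3.hrk_of_layer_count` whose closed sublayers `Ψ`, `V = W[p]`, `N = Ker q̄ ∩ W[p]` are ★ `exists_interLayer` kernels and whose ONE numeric row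
`hcount` is read from the two A-level counts `hrkw` («`rk Γ(A_x̄[𝔭_w]) = q²`», (γ)) and `hrkN` («`rk Γ(Ker q̄ ∩ A_x̄[𝔭_w]) = q`», (k2b)) — LA3-p03 (g3)'s rows — plus
`rk Γ(Φ𝒢) = q` (★ `DockKernelReading.finrank_alg_eq_of_layer_comp_eq_one` at the dock Frobenius law `hF` and the saturation `hsat`); (3) the bridge «`𝔭_wⁿ`-torsion ∧
`q`-torsion ⇒ fixed by `ι(ē)`», `ē = star εu ≡ 1 (mod 𝔭_w^f)`, `(p) = 𝔭_w·𝔟`, `ē ∈ 𝔟^f`.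

INPUTS BY NAME (binders): the dock `𝔡`; the leg `qbar` (homomorphism into an abelian scheme `B̄`) with (r3₀-q) `r3` at `B̄`'s normalised dual pair and (r4₀-q) `hr4`;
the ARITHMETIC of the block idempotents at level `q` (`εu c he`, `𝔟 hp𝔟 hw𝔟 hē1 hē0 hεu1 hεu0`) and the co-ideal rows `h𝔠₁ h𝔠₂` (★ `FrobeniusCoidealBlockCongruence.frobCoideal_block_rows`;
organ (W-α), B-p08 (g35)); the ROOF road's dock clauses and kernel rows `hkerq hdock hF hsat` (W2 `Lines/F0_P6a_RoofCwKernel.lean` binders VERBATIM; `hsat := hsat_sch₀Of …`);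
the two counts `hrkw hrkN` (organ (W-γ), LA3-p03 (g3)).

* §1 `one_le_fDeg` (from `hfDeg`); the bridge congruence `ē − 1 ∈ 𝔭_wⁿ ⊔ (q)` = ★ `Literature.NumberTheory.NumberFields.sub_one_mem_pow_sup_span` (imported, ED. 2 v2); (§1b of ED. 1 = ★ `Theorems.F0P6bWeilShiftedIsotropy`, imported);
* §2 GENERIC `hlaw_w_of_wDockPackage`; §3 HEAD **`hlaw_w_sch₀Of`** (one `exact` at `x̄`); §4 **`hlaw_w_sch₀Of_of_twistNorm`** (arithmetic paid by ★ p850351).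

## References
* [MumfordAV1970] D. Mumford, *Abelian Varieties* (1970), §20 (I) (p. 186), §23 Thm. 2 (p. 231).
* [Tate1997FiniteFlatGroupSchemes] J. Tate, *Finite flat group schemes* (1997), §(3.7)–(3.8) (pp. 144–146).
* [Liu2021] Y. Liu, *Fourier–Jacobi cycles and arithmetic relative trace formula*, Camb. J. Math. 9 (2021), Prop. D.8 (3) pp. 136–138.
* [Neukirch1999] J. Neukirch, *Algebraic Number Theory* (1999), Ch. I §3 (3.6).
-/

set_option autoImplicit false
set_option linter.dupNamespace false

-- Mathlib's `Over`/`Scheme` APIs and the W-DOCK package are stated across semireducible wrappers.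
set_option backward.isDefEq.respectTransparency false

noncomputable section

universe u

namespace Summit.HodgeConjecture.HodgeConjecture.Cruxes.HLiu418.F0P6aRoofWInstantiation

open CategoryTheory CategoryTheory.Limits AlgebraicGeometry NumberField IsDedekindDomain MulAction
open scoped Matrix Pointwise MonoidalCategory MonObj CategoryTheory.Obj
open Literature.NumberTheory.GaloisRepresentations
open Literature.NumberTheory.Automorphic Literature.NumberTheory.Automorphic.UnitaryGroup
open Literature.AlgebraicGeometry.ShimuraVarieties.UnitaryCanonicalModel
open Literature.NumberTheory.Automorphic.Liu2021.AppendixC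
open Literature.AlgebraicGeometry.Motives (AlgPoints IntegralModel SchemeOver thickening thickeningLift specOver relFrobeniusOver frobeniusTwistOver frobSpec)
open Literature.NumberTheory.DiophantineGeometry (geomResidueField specResidueField)
open Literature.AlgebraicGeometry.RelativeSpec (ActionOver)
open Literature.AlgebraicGeometry.GroupSchemes Literature.AlgebraicGeometry.GroupSchemes.GroupSchemeKernel
open Literature.AlgebraicGeometry.GroupSchemes.AffineGroupScheme Literature.AlgebraicGeometry.GroupSchemes.TorsionLayer
open Literature.AlgebraicGeometry.AbelianSchemes Literature.AlgebraicGeometry.AbelianSchemes.AbelianSchemeOver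
open Literature.AlgebraicGeometry.AbelianSchemes.AbelianSchemeOver.DualPair
open Literature.AlgebraicGeometry.AbelianSchemes.WeilPairing
open Literature.AlgebraicGeometry.AbelianSchemes.DockKernelReading
open Summit.HodgeConjecture.HodgeConjecture.Cruxes.HLiu418.F0P6aModuliDatumDefs
open Summit.HodgeConjecture.HodgeConjecture.Cruxes.HLiu418.F0P6aRGDAssembly
open Summit.HodgeConjecture.HodgeConjecture.Cruxes.HLiu418.F0P6aDatumOfInputs
open Summit.HodgeConjecture.HodgeConjecture.Cruxes.HLiu418.F0P6bWeilCartierDuality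
open Summit.HodgeConjecture.HodgeConjecture.Cruxes.HLiu418.F0P6bWDock
open Summit.HodgeConjecture.HodgeConjecture.Cruxes.HLiu418.F0P6bWeilShiftedIsotropy (e₀_comp_cartierDualMap_eq_one_of_zsmul_comp_eq_one hiso_e₀)

/-! ### §1 Arithmetic glue

ED. 2 (v2): the bridge congruence `sub_one_mem_pow_sup_span` («`ē − 1 ∈ 𝔭^f`, `(q) = 𝔭^f·𝔟^f`, `𝔭 ⊔ 𝔟 = ⊤` ⇒ `ē − 1 ∈ 𝔭ⁿ ⊔ (q)` for every `n`») is no longer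
copied here: it is ★ `Literature.NumberTheory.NumberFields.sub_one_mem_pow_sup_span` (`GaloisConjugatePrimeIdealArithmetic.lean` ED. 2 §CRT, p851411; LA1-p01 (g4)
RETIRE-MAP 12:17:22Z, same binders `{𝔭 𝔟 : Ideal R} {f : ℕ} {e q : R} (he) (hq) (hcop) (n)` over `[CommRing R]`), brought into scope by the one-name `open` below. -/

open Literature.NumberTheory.NumberFields (sub_one_mem_pow_sup_span)

/-! ### §2 HEAD — the `w`-block law at `x̄` -/

section Head

variable {F : Type} [Field F] [NumberField F] [IsCMField F] {ι₁ : F →+* ℂ}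
    {Jstar : Matrix (Fin 2) (Fin 2) F}
    {K₀ : C5.OpenCompactSubgroup ↥(finAdelic ↥(maximalRealSubfield F) F (IsCMField.complexConj F) 2 Jstar)}
    {S : RecordSystemGS F Jstar ι₁ K₀} {hU7ₛ : S.HeckeTranslateDefinedOver}
    {hJ : (Jstar.map (IsCMField.complexConj F))ᵀ = Jstar} {hJu : IsUnit Jstar}
    {Fi : Type} [Field Fi] [Algebra F Fi] {Kc : C5.SmallLevel K₀} {G : Type} [Group G]
    {𝓜 : IntegralModel (𝓞 F) F ((thickening F Fi).obj (S.M.obj Kc))}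
    {w : HeightOneSpectrum (𝓞 F)} {hw : (IsCMField.complexConj F) • w ≠ w} {h𝓨 : (𝓜.localise w).IsSmoothProper 1}
    {θ : ActionOver (𝓜.localise w).total.hom ((Fi ≃ₐ[F] Fi) × G)}
    {e : Fi →ₐ[F] AlgebraicClosure (w.adicCompletion F)}

/-- `1 ≤ f_w` (`N(c•w) = p^{f_w}` is the cardinality of a nontrivial finite quotient: `hfDeg`). [cite: Neukirch1999, Ch. I §3 (3.6)] -/
theorem one_le_fDeg (I : RGDInputsAt F ι₁ Jstar K₀ S hU7ₛ hJ hJu Fi Kc G 𝓜 w hw h𝓨 θ e) : 1 ≤ I.fDeg := by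
  refine Nat.one_le_iff_ne_zero.mpr fun h => ?_
  have hcard : Nat.card (𝓞 F ⧸ ((IsCMField.complexConj F) • w).asIdeal) = 1 := by simpa [h] using I.hfDeg
  haveI : Nontrivial (𝓞 F ⧸ ((IsCMField.complexConj F) • w).asIdeal) :=
    Ideal.Quotient.nontrivial_iff.mpr ((IsCMField.complexConj F) • w).isMaximal.ne_top
  haveI : Finite (𝓞 F ⧸ ((IsCMField.complexConj F) • w).asIdeal) := Nat.finite_of_card_ne_zero (by rw [hcard]; exact one_ne_zero)
  have h1 : 1 < Nat.card (𝓞 F ⧸ ((IsCMField.complexConj F) • w).asIdeal) := Finite.one_lt_card_iff_nontrivial.mpr inferInstance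
  omega


/-! ### §2 THE `w`-BLOCK LAW FROM A W-DOCK PACKAGE — generic over the package data (small terms, DEFAULT budgets; the `x̄`-instance §3 is one `exact`) -/

section Generic

variable {k : Type u} [Field k]

/-- **`hlaw_w_of_wDockPackage` — THE `w`-BLOCK LAW FROM THE PACKAGE, THE DOCK, THE LEG AND THE COUNTS (generic).**  For an abelian scheme `A∕k` (`k` perfect,
characteristic `p`) with `𝒪`-action `act`, dual pair `D`, polarisation `pol`, a W-DOCK package at the `c•w`-block idempotent `εu` of level `q = p^r`
(`hpkg : WDockPackage k p r A D pol star act εu`), the `𝔴c`-DOCK `ι₀G : G₀ ↪ A` (`hkerG₀`, an ideal `I ⊆ Γ(G₀)` of colength `q`: `hrkI`), a homomorphism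
`q̄ : A → B` onto an abelian scheme with (r3₀-q) `r3` and (r4₀-q) `hr4`, the arithmetic of `ē = star εu` ∕ `εu` at the places `𝔴` (`w`) ∕ `𝔴c` (`c•w`) and the
co-ideal rows `h𝔠₁ h𝔠₂`, the ROOF road's rows `hkerq hdock hF hsat` and the two `w`-side counts `hrkw hrkN` — all read through a second token family `ιt a = act.i a`
(`hact`; at `x̄`: `act₀Of`) —: for every `n` and every `q`-torsion `T`-point `x` of `A` killed by `𝔴ⁿ`, `x ≫ F_q = 1 ↔ ∀ a ∈ 𝔠, x ≫ ιt(a) ≫ q̄ = 1`.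
CHAIN: `WBlockLawED4b.law_w_of_points` at `𝒦 := Φ𝒢` (`hE := Iff.rfl`), `hqβ := hqβ_of_descends ∘ hr4`, (KW) `:= WBlockLawED4c.hKW_of_isotropy_of_finrank` over
(I-iso) `hiso_e₀` (★ `Theorems.F0P6bWeilShiftedIsotropy`, §1b of ED. 1; its `h𝒦` = «`Φ𝒢 ⊆ Ker q̄`» from `hF`∕`hsat`∕`hdock`) and (I-rk) `WBlockLawLA3.hrk_of_layer_count` on the ★ `exists_interLayer` sublayers
`V = W[p]`, `N = Ker q̄ ∩ V`, `Ψ`, with `hcount` from `hrkw`∕`hrkN` (via `WBlockLawLA3.layer_points_iff`) and `rk Γ(Φ𝒢) = q` (★ `DockKernelReading.finrank_alg_eq_of_layer_comp_eq_one`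
at `hF`); then the bridge §1. [cite: MumfordAV1970, §20 (I) p. 186, §23 Thm. 2 p. 231] [cite: Tate1997FiniteFlatGroupSchemes, §(3.8) p. 146] [cite: Liu2021, Prop. D.8 (3) pp. 136–138] -/
theorem hlaw_w_of_wDockPackage [PerfectField k] (p r : ℕ) [Fact p.Prime] [CharP k p] [ExpChar k p] (hr : 1 ≤ r)
    (A : AbelianSchemeOver (Spec (.of k))) (D : A.DualPair) (pol : A.Polarization D)
    {O : Type} [CommRing O] (star : O →+* O) (act : A.RingAction O) (εu : O)
    (hpkg : WDockPackage k p r A D pol star act εu)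
    -- the action read through a second token family (at `x̄`: `act₀Of … a x̄`)
    (ιt : O → (A.X ⟶ A.X)) (hact : ∀ a, act.i a = ιt a)
    -- the two places `𝔴 = 𝔭_w`, `𝔴c = 𝔭_{c•w}` and the `𝔴c`-dock
    (𝔴 𝔴c : Ideal O) (G₀ : SchemeOver k) [IsAffine G₀.left] (ι₀G : G₀ ⟶ A.X) [Mono ι₀G]
    (hkerG₀ : ∀ ⦃T : SchemeOver k⦄ (t : T ⟶ A.X), (∀ r' ∈ 𝔴c, t ≫ act.i r' = 1) ↔ ∃ s : T ⟶ G₀, s ≫ ι₀G = t)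
    (I : Ideal (Alg G₀)) (hrkI : Module.finrank k (Alg G₀ ⧸ I) = p ^ r)
    -- the reduced leg of the roof: a homomorphism into an abelian scheme, with (r3₀-q) at `[p]` and (r4₀-q)
    {B : AbelianSchemeOver (Spec (.of k))} (qbar : A.X ⟶ B.X) [IsMonHom qbar]
    (DB : B.DualPair) (hDB : Nonempty ((Scheme.Modules.pullback DB.unitHatSlice).obj DB.P ≅ SheafOfModules.unit _))
    (lamB : B.X ⟶ DB.hat.X) [IsMonHom lamB] (r3 : qbar ≫ lamB ≫ dualIsogenyOver qbar D DB = pol.lam ≫ D.hat.mulN p)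
    (hr4 : ∀ a : O, ∃ b : B.X ⟶ B.X, ιt a ≫ qbar = qbar ≫ b)
    -- the arithmetic of `ē = star εu` (the `w`-block) and `εu` (the `c•w`-block), and the co-ideal rows
    (𝔠 𝔟 : Ideal O) (hp𝔟 : Ideal.span {(p : O)} = 𝔴 * 𝔟) (hw𝔟 : 𝔴 ⊔ 𝔟 = ⊤)
    (hē1 : star εu - 1 ∈ 𝔴 ^ r) (hē0 : star εu ∈ 𝔟) (hεu1 : εu - 1 ∈ 𝔴c) (hp𝔴c : (p : O) ∈ 𝔴c)
    (hεu0 : ∀ b ∈ 𝔴c ^ r, b * εu ∈ Ideal.span {((p ^ r : ℕ) : O)})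
    (h𝔠₁ : ∀ a ∈ 𝔠, ∃ b c₁ : O, a * star εu = ((p ^ (r - 1) : ℕ) : O) * b + ((p ^ r : ℕ) : O) * c₁)
    (h𝔠₂ : ∃ a ∈ 𝔠, ∃ b c₂ : O, ((p ^ (r - 1) : ℕ) : O) * star εu = a * b + ((p ^ r : ℕ) : O) * c₂)
    -- the ROOF road's kernel bound, dock clauses and saturation
    (hkerq : ∀ ⦃T : SchemeOver k⦄ (z : T ⟶ A.X), z ≫ qbar = 1 → ∀ b ∈ 𝔴 * 𝔴c, z ≫ ιt b = 1)
    (hdock : ∀ ⦃T : SchemeOver k⦄ (t : T ⟶ G₀), t ≫ ι₀G ≫ qbar = 1 ↔ ∃ s : T ⟶ specOver k (Alg G₀ ⧸ I), s ≫ quotIncl G₀ I = t)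
    (hF : ∀ ⦃T : SchemeOver k⦄ (t : T ⟶ G₀),
      t ≫ ι₀G ≫ relFrobeniusOver p r A.X = (1 : T ⟶ (A.baseChange (frobSpec k p r)).X) ↔
        ∃ s : T ⟶ specOver k (Alg G₀ ⧸ I), s ≫ quotIncl G₀ I = t)
    (hsat : ∀ (n : ℕ) ⦃T : SchemeOver k⦄ (x : T ⟶ A.X), (∀ b ∈ 𝔴c ^ n, x ≫ ιt b = 1) →
      x ≫ relFrobeniusOver p r A.X = (1 : T ⟶ (A.baseChange (frobSpec k p r)).X) → ∀ b ∈ 𝔴c, x ≫ ιt b = 1)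
    -- the two counts on the `w`-side, realisation-free
    (hrkw : ∀ {Z : SchemeOver k} (ζ : Z ⟶ A.X) [Mono ζ],
      (∀ ⦃T : SchemeOver k⦄ (x : T ⟶ A.X), (∃ z : T ⟶ Z, z ≫ ζ = x) ↔ ∀ r' ∈ 𝔴, x ≫ ιt r' = 1) →
      Module.finrank k (Alg Z) = p ^ r * p ^ r)
    (hrkN : ∀ {Z : SchemeOver k} (ζ : Z ⟶ A.X) [Mono ζ],
      (∀ ⦃T : SchemeOver k⦄ (x : T ⟶ A.X), (∃ z : T ⟶ Z, z ≫ ζ = x) ↔ (∀ r' ∈ 𝔴, x ≫ ιt r' = 1) ∧ x ≫ qbar = 1) →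
      Module.finrank k (Alg Z) = p ^ r) :
    ∀ (n : ℕ) ⦃T : SchemeOver k⦄ (x : T ⟶ A.X), x ≫ A.mulN (p ^ r) = 1 → (∀ b ∈ 𝔴 ^ n, x ≫ ιt b = 1) →
      ((x ≫ relFrobeniusOver p r A.X = (1 : T ⟶ (A.baseChange (frobSpec k p r)).X)) ↔ ∀ a ∈ 𝔠, x ≫ ιt a ≫ qbar = 1) := by
  -- (0) one token family: `ιt = act.i`
  obtain rfl : ιt = act.i := funext fun a => (hact a).symm
  have hp : p ≠ 0 := (Fact.out : p.Prime).ne_zero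
  haveI : IsCommMonObj A.X := AbelianSchemeOver.isCommMonObj_of_field _
  haveI : IsSeparated B.X.hom := B.isSeparated_hom
  -- (1) THE PACKAGE
  obtain ⟨G', _, _, _, _, _, j, _, _, hG, Φ, _, _, _, _, _, φ, _, _, hΦ, Ĝ, _, _, _, _, _, ĵ, _, _, hĜ,
      β, hβm, hβj, hβ1, hβadd, hβmul, hq, hidem𝒢, hidemW, hlamG,
      W, _, _, _, _, _, jW, _, _, hW, 𝒢l, _, _, _, _, _, j𝒢, _, _, h𝒢, Φ𝒢, _, _, _, _, _, φ𝒢, _, _, hΦ𝒢,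
      eW, heW, he₀, hherm, hlag, hdock₄, hlaw₅⟩ := hpkg
  haveI : ∀ a, IsMonHom (β a) := hβm
  haveI : Mono j := Over.mono_of_mono_left j
  haveI : Mono jW := Over.mono_of_mono_left jW
  haveI : Mono j𝒢 := Over.mono_of_mono_left j𝒢
  haveI : Mono φ𝒢 := Over.mono_of_mono_left φ𝒢
  -- (2) THE SUBLAYERS `V = W[p]`, `N = Ker q̄ ∩ V`, `Ψ = Ker (β s ≫ j ≫ q̄) ∩ W` (★ `exists_interLayer`) and the shift `φs : W → V`
  obtain ⟨V, _, _, _, _, _, jV, _, _, hV0⟩ := exists_interLayer W (jW ≫ β ((p : ℕ) : O))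
  haveI : Mono jV := Over.mono_of_mono_left jV
  have hV : ∀ ⦃T : SchemeOver k⦄ (x : T ⟶ W), (∃ s : T ⟶ V, s ≫ jV = x) ↔ (x ≫ jW) ≫ β ((p : ℕ) : O) = 1 :=
    fun T x => by rw [hV0 x, Category.assoc]
  obtain ⟨N, _, _, _, _, _, νN, _, _, hN0'⟩ := exists_interLayer V (jV ≫ jW ≫ j ≫ qbar)
  haveI : Mono νN := Over.mono_of_mono_left νN
  have hN : ∀ ⦃T : SchemeOver k⦄ (d : T ⟶ V), (∃ e' : T ⟶ N, e' ≫ νN = d) ↔ (((d ≫ jV) ≫ jW) ≫ j) ≫ qbar = 1 :=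
    fun T d => by rw [hN0' d]; simp only [Category.assoc]
  obtain ⟨Ψ, _, _, _, _, _, ψ, _, _, hΨ0⟩ := exists_interLayer W (jW ≫ β ((p ^ (r - 1) : ℕ) : O) ≫ j ≫ qbar)
  haveI : Mono ψ := Over.mono_of_mono_left ψ
  have hΨ : ∀ ⦃T : SchemeOver k⦄ (x : T ⟶ W),
      (∃ c' : T ⟶ Ψ, c' ≫ ψ = x) ↔ (((x ≫ jW) ≫ β ((p ^ (r - 1) : ℕ) : O)) ≫ j) ≫ qbar = 1 :=
    fun T x => by rw [hΨ0 x]; simp only [Category.assoc]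
  obtain ⟨φs, hφs⟩ := WBlockLawLA3.exists_shiftHom (p := p) (r := r) (star := star) (εu := εu) (G := G') (β := β) (hβ1 := hβ1)
    (hβadd := hβadd) (hβmul := hβmul) (hq := hq) (W := W) (jW := jW) (hW := hW) (V := V) (jV := jV) (hV := hV) hr
  -- (3) THE `𝔴`-SIDE READINGS: `V = A[𝔴]` on all `T`-points (W-DOCK §6.8 `layer_points_iff` at `w′ = 𝔴`), hence the two counts
  have hē1' : star εu - 1 ∈ 𝔴 := Ideal.pow_le_self (by omega) hē1
  have hVpts := WBlockLawLA3.layer_points_iff (p := p) (r := r) (A := A) (star := star) (act := act) (εu := εu) (G := G') (j := j) (β := β)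
    (hG := hG) (hβj := hβj) (hβmul := hβmul) (W := W) (jW := jW) (hW := hW) (V := V) (jV := jV) (hV := hV) (w' := 𝔴) (𝔟' := 𝔟)
    (hpw' := hp𝔟) (hε1 := hē1') (hε0 := hē0) hr
  have hrkV : Module.finrank k (Alg V) = p ^ r * p ^ r := by
    haveI : Mono ((jV ≫ jW) ≫ j) := mono_comp _ _
    refine hrkw ((jV ≫ jW) ≫ j) fun T x => ⟨fun ⟨z, hz⟩ r' hr' => ?_, fun h => ?_⟩
    · exact (hVpts x).1 ⟨z, by simpa only [Category.assoc] using hz⟩ r' hr'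
    · obtain ⟨z, hz⟩ := (hVpts x).2 fun r' hr' => h r' hr'
      exact ⟨z, by simpa only [Category.assoc] using hz⟩
  have hrkN' : Module.finrank k (Alg N) = p ^ r := by
    haveI : Mono (((νN ≫ jV) ≫ jW) ≫ j) := mono_comp _ _
    refine hrkN (((νN ≫ jV) ≫ jW) ≫ j) fun T x => ?_
    constructor
    · rintro ⟨z, rfl⟩
      refine ⟨(hVpts _).1 ⟨z ≫ νN, by simp only [Category.assoc]⟩, ?_⟩
      have h := (hN (z ≫ νN)).1 ⟨z, rfl⟩
      simpa only [Category.assoc] using h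
    · rintro ⟨hxw, hxq⟩
      obtain ⟨d, hd⟩ := (hVpts x).2 hxw
      obtain ⟨z, rfl⟩ := (hN d).2 (by rw [hd]; exact hxq)
      exact ⟨z, by rw [← hd]; simp only [Category.assoc]⟩
  -- (4) THE `𝔴c`-SIDE: `G' = A[q]`-points are `q`-torsion; `𝒢l` is `𝔴c^r`-primary; the dock sits inside `𝒢l`; `rk Γ(Φ𝒢) = q`; `Φ𝒢 ⊆ Ker q̄`
  have hGtors : ∀ ⦃T : SchemeOver k⦄ (z : T ⟶ G'), (z ≫ j) ≫ A.mulN (p ^ r) = 1 := fun T z => by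
    rw [mulN_eq_zsmul_id]; exact (hG (z ≫ j)).1 ⟨z, rfl⟩
  have h𝒢lprim : ∀ ⦃T : SchemeOver k⦄ (y : T ⟶ 𝒢l), ∀ b ∈ 𝔴c ^ r, ((y ≫ j𝒢) ≫ j) ≫ act.i b = 1 := fun T y => by
    have hfix : ((y ≫ j𝒢) ≫ j) ≫ act.i εu = (y ≫ j𝒢) ≫ j := by
      rw [Category.assoc, ← hβj, ← Category.assoc, (h𝒢 (y ≫ j𝒢)).1 ⟨y, rfl⟩]
    exact act.forall_comp_i_eq_one_of_mul_mem_span ((y ≫ j𝒢) ≫ j) (hGtors (y ≫ j𝒢)) hfix hεu0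
  -- the dock lands in `𝒢l`: `l₀ : G₀ → 𝒢l` with `l₀ ≫ j𝒢 ≫ j = ι₀G`
  have hqmem : ((p ^ r : ℕ) : O) ∈ 𝔴c := by
    rw [Nat.cast_pow]; exact Ideal.pow_mem_of_mem _ hp𝔴c _ hr
  have hι₀tors : ι₀G ≫ A.mulN (p ^ r) = 1 := by
    rw [mulN_def, ← RingAction.i_natCast act (p ^ r)]
    exact (hkerG₀ ι₀G).2 ⟨𝟙 _, Category.id_comp _⟩ _ hqmem
  have hι₀zs : ι₀G ≫ ((((p ^ r : ℕ) : ℤ) • 𝟙 A.toAffine.toAbelianVariety).hom.hom.hom) = 1 := by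
    rw [← mulN_eq_zsmul_id]; exact hι₀tors
  obtain ⟨s₀, hs₀⟩ := (hG ι₀G).2 hι₀zs
  have hs₀fix : s₀ ≫ β εu = s₀ := by
    have ht : ∀ b ∈ 𝔴c, (s₀ ≫ j) ≫ act.i b = 1 := (hkerG₀ (s₀ ≫ j)).2 ⟨𝟙 _, by rw [Category.id_comp, hs₀]⟩
    rw [← cancel_mono j, Category.assoc, hβj, ← Category.assoc]
    exact act.comp_i_eq_self_of_sub_one_mem (s₀ ≫ j) ht hεu1
  obtain ⟨l₀, hl₀⟩ := (h𝒢 s₀).2 hs₀fix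
  have hl₀' : l₀ ≫ (j𝒢 ≫ j) = ι₀G := by rw [← Category.assoc, hl₀, hs₀]
  -- the reading of `Φ𝒢` in the ROOF road's Frobenius currency (★ W-DOCK `relFrobenius_toAbelianVariety_eq` is `rfl`)
  have hΦ𝒢' : ∀ ⦃T : SchemeOver k⦄ (y : T ⟶ 𝒢l), (∃ c' : T ⟶ Φ𝒢, c' ≫ φ𝒢 = y) ↔
      (y ≫ (j𝒢 ≫ j)) ≫ relFrobeniusOver p r A.X = (1 : T ⟶ (A.baseChange (frobSpec k p r)).X) := fun T y => by
    rw [hΦ𝒢 y, ← Category.assoc]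
    exact Iff.rfl
  have hFdown : ∀ ⦃T : SchemeOver k⦄ (y : T ⟶ 𝒢l),
      (y ≫ (j𝒢 ≫ j)) ≫ relFrobeniusOver p r A.X = (1 : T ⟶ (A.baseChange (frobSpec k p r)).X) →
      ∀ r' ∈ 𝔴c, (y ≫ (j𝒢 ≫ j)) ≫ act.i r' = 1 := fun T y hy =>
    hsat r (y ≫ (j𝒢 ≫ j)) (fun b hb => by simpa only [Category.assoc] using h𝒢lprim y b hb) hy
  have hrkΦ𝒢 : Module.finrank k (Alg Φ𝒢) = p ^ r := by
    haveI : Mono (j𝒢 ≫ j) := mono_comp _ _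
    have h := finrank_alg_eq_of_layer_comp_eq_one A act 𝔴c G₀ ι₀G hkerG₀ I (relFrobeniusOver p r A.X) hF (j𝒢 ≫ j) l₀ hl₀' hFdown φ𝒢 hΦ𝒢'
    rw [h]
    exact hrkI
  -- `Φ𝒢 ⊆ Ker q̄`: a point of `𝒢l` killed by `F_q` lands on the dock (saturation), lies in `V(I)` (`hF`), hence is killed by `q̄` (`hdock`)
  have hΦq : ((φ𝒢 ≫ j𝒢) ≫ j) ≫ qbar = 1 := by
    have hyF : (φ𝒢 ≫ (j𝒢 ≫ j)) ≫ relFrobeniusOver p r A.X = (1 : _ ⟶ (A.baseChange (frobSpec k p r)).X) :=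
      (hΦ𝒢' φ𝒢).1 ⟨𝟙 _, Category.id_comp _⟩
    obtain ⟨g, hg⟩ := (hkerG₀ (φ𝒢 ≫ (j𝒢 ≫ j))).1 (hFdown φ𝒢 hyF)
    have hgF := (hF g).1 (by rw [← Category.assoc, hg]; exact hyF)
    have hgq := (hdock g).2 hgF
    rw [← Category.assoc, hg, Category.assoc] at hgq
    exact hgq
  -- (5) THE COUNT `hcount`, the complementary rank `hrk`, the (KW) socket
  have hcount : Module.finrank k (Alg V) = Module.finrank k (Alg N) * Module.finrank k (Alg Φ𝒢) := by
    rw [hrkV, hrkN', hrkΦ𝒢]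
  have hN0 : 0 < Module.finrank k (Alg N) := by
    rw [hrkN']; exact pow_pos (Fact.out : p.Prime).pos _
  have hrk := WBlockLawLA3.hrk_of_layer_count (p := p) (r := r) (A := A) (star := star) (act := act) (εu := εu) (G := G') (j := j) (β := β)
    (hG := hG) (hβj := hβj) (hβmul := hβmul) (hidemW := hidemW) (W := W) (jW := jW) (hW := hW) (V := V) (jV := jV) (hV := hV) (φ := φs)
    (hφ := hφs) (N := N) (νN := νN) (qbar := qbar) (hN := hN) (Ψ := Ψ) (ψ := ψ) (hΨ := hΨ) hp hr Φ𝒢 hcount hN0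
  have hD : Nonempty ((Scheme.Modules.pullback D.unitHatSlice).obj D.P ≅ SheafOfModules.unit _) := pol.nonempty_unitHatSlice_iso
  have hiso : ∀ ⦃T : SchemeOver k⦄ (x : T ⟶ W), (((x ≫ jW) ≫ β ((p ^ (r - 1) : ℕ) : O)) ≫ j) ≫ qbar = 1 →
      ((x ≫ jW) ≫ (e₀ p r A.toAffine.toAbelianVariety D pol j hG ĵ hĜ hlamG).hom) ≫ cartierDualMap (φ𝒢 ≫ j𝒢) = 1 := fun T x hx =>
    hiso_e₀ p r hr A D hD pol G' j hG Ĝ ĵ hĜ hlamG β hβ1 hβadd W jW 𝒢l j𝒢 Φ𝒢 φ𝒢 qbar DB hDB lamB r3 hΦq x hx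
  have hKW := WBlockLawED4c.hKW_of_isotropy_of_finrank A G' j β W jW 𝒢l j𝒢 Φ𝒢 φ𝒢 eW
    (e₀ p r A.toAffine.toAbelianVariety D pol j hG ĵ hĜ hlamG).hom hdock₄ qbar ((p ^ (r - 1) : ℕ) : O) hiso Ψ ψ hΨ hrk
  -- (6) THE HEAD of the W-DOCK at `𝒦 := Φ𝒢` (the (E) socket is `Iff.rfl`), with `hqβ` from (r4₀-q)
  have hqβ := WBlockLaw.hqβ_of_descends A act G' j β hβj qbar hr4
  have hmain := WBlockLawED4b.law_w_of_points p r A star act εu G' j β W jW hβj hβ1 hβadd hβmul hq hW qbar 𝔠 ((p ^ (r - 1) : ℕ) : O)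
    hqβ h𝔠₁ h𝔠₂ 𝒢l Φ𝒢 φ𝒢 Φ𝒢 φ𝒢 eW (fun _ _ => Iff.rfl) hlaw₅ hKW hG
  -- (7) THE BRIDGE: a `q`-torsion point killed by `𝔴ⁿ` is fixed by `ιt(ē)`
  intro n T x hxN hxw
  have hq𝔟 : Ideal.span {((p ^ r : ℕ) : O)} = 𝔴 ^ r * 𝔟 ^ r := by
    rw [Nat.cast_pow, ← Ideal.span_singleton_pow, hp𝔟, mul_pow]
  have hfix : x ≫ act.i (star εu) = x := by
    refine act.comp_i_eq_self_of_sub_one_mem x ?_ (sub_one_mem_pow_sup_span hē1 hq𝔟 hw𝔟 n)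
    exact (RingAction.forall_mem_sup_iff act x).2 ⟨hxw, fun b hb => act.comp_i_eq_one_of_mem_span_of_comp_mulN x hxN hb⟩
  exact hmain x hxN hfix

end Generic


/-! (★ re-home, size lint: PART 1 of 2 ends here at tree line :307; the workfile continues, in the same namespace, in `Theorems/F0P6aRoofWInstantiation.lean`.) -/

end Head
end Summit.HodgeConjecture.HodgeConjecture.Cruxes.HLiu418.F0P6aRoofWInstantiation
end
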